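import Mathlib.AlgebraicGeometry.Morphisms.Smooth
import Mathlib.AlgebraicGeometry.Morphisms.Separated
import Mathlib.AlgebraicGeometry.Morphisms.QuasiCompact
import Mathlib.AlgebraicGeometry.Morphisms.FiniteType
import Mathlib.AlgebraicGeometry.Morphisms.Affine
import Mathlib.AlgebraicGeometry.Noetherian
import Literature.AlgebraicGeometry.Resolution.WeightedResolutionDatum
import Literature.AlgebraicGeometry.Resolution.SmoothOfRegularPerfectField
import Literature.AlgebraicGeometry.Resolution.ProjectiveSpaceRegular
import Literature.AlgebraicGeometry.Resolution.AlterationsProofs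

/-!
# The cobordant blow-up chart `B₊(U) → Spec k` is smooth, separated and quasi-compact

Route `ResolutionOfSingularities/WeightedInvariant`, crux `WeightedConstruction`
(stmt-ResolutionOfSingularities-0571), line `support-first-weights-second`, stub
`stub_cobordantPlus_smooth_of_isRegularRing`.

For a Rees algebra `R` on a scheme `Y` over a perfect field `k` (`f : Y → Spec k` smooth,
separated, quasi-compact) and an affine open `U ⊆ Y`, write `A := Γ(Y, U)` and
`S := A[t⁻¹, Rₙ(U) tⁿ]` (`extReesAlgebra (R.chartIdeals U)`), so that the full cobordant blow-up
of the chart is `B(U) = Spec S` and `B₊(U) = R.cobordantPlus U` is its open subscheme off the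
vertex, with structure map
`R.cobordantPlusι U ≫ f = ((B₊(U) ↪ Spec S) ≫ Spec (A → S)) ≫ (Spec A ≅ U ↪ Y) ≫ f`.
Assuming `S` is a regular ring of finite type over `A` we prove (Włodarczyk, *Functorial
resolution by torus actions*, 2.3.9, for the datum's charts):

* `Smooth (R.cobordantPlusι U ≫ f)`: `B₊(U)` is an open subscheme of the regular scheme `Spec S`,
  hence regular, and locally of finite type over `k`; a regular scheme locally of finite type
  over a perfect field is smooth (`smooth_of_isRegular_of_perfectField`).
* `IsSeparated (R.cobordantPlusι U ≫ f)`: a composition of open immersions, a morphism of affine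
  schemes and the separated `f`.
* `QuasiCompact (R.cobordantPlusι U ≫ f)`: `S` is Noetherian, so `Spec S` and its open subspace
  `B₊(U)` are Noetherian topological spaces, and every morphism out of a Noetherian scheme is
  quasi-compact.

The morphisms `affineCobordantBlowup.plusπ`, `affineCobordantBlowup.π`, `ReesAlgebraData.cobordantPlusι`
and the schemes `affineCobordantBlowup`, `affineCobordantBlowup.plus`, `ReesAlgebraData.cobordantPlus`
are plain definitions, invisible to instance resolution; so every instance is assembled by hand
with `MorphismProperty.comp_mem` from instances stated on the unfolded pieces.
-/

set_option linter.dupNamespace false -- mandated namespace of this single-conjunct summit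

namespace Summit.ResolutionOfSingularities.ResolutionOfSingularities.Theorems

open CategoryTheory AlgebraicGeometry TopologicalSpace Literature.AlgebraicGeometry.Resolution
open scoped LaurentPolynomial

universe u

section Affine

variable {A : Type u} [CommRing A] (I : ℕ → Ideal A)

/-- The cobordant blow-up morphism `σ₊ : B₊ → Spec A` is separated: it is the open immersion
`B₊ ↪ B = Spec A[t⁻¹, Iₙ tⁿ]` followed by a morphism of affine schemes. [folklore] -/
theorem affineCobordantBlowup_plusπ_isSeparated :
    IsSeparated (affineCobordantBlowup.plusπ I) := by
  have hπ : IsSeparated (affineCobordantBlowup.π I) :=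
    (inferInstance :
      IsSeparated (Spec.map (CommRingCat.ofHom (algebraMap A (extReesAlgebra I)))))
  have hι : IsSeparated (affineCobordantBlowup.plusOpens I).ι := inferInstance
  exact MorphismProperty.comp_mem @IsSeparated _ _ hι hπ

/-- If `A[t⁻¹, Iₙ tⁿ]` is of finite type over `A`, the cobordant blow-up morphism
`σ₊ : B₊ → Spec A` is locally of finite type. [folklore] -/
theorem affineCobordantBlowup_plusπ_locallyOfFiniteType
    (hft : Algebra.FiniteType A (extReesAlgebra I)) :
    LocallyOfFiniteType (affineCobordantBlowup.plusπ I) := by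
  have hSpec : LocallyOfFiniteType
      (Spec.map (CommRingCat.ofHom (algebraMap A (extReesAlgebra I)))) :=
    (HasRingHomProperty.Spec_iff (P := @LocallyOfFiniteType)).mpr
      (show (CommRingCat.ofHom (algebraMap A (extReesAlgebra I))).hom.FiniteType from
        RingHom.finiteType_algebraMap.mpr hft)
  have hπ : LocallyOfFiniteType (affineCobordantBlowup.π I) := hSpec
  have hι : LocallyOfFiniteType (affineCobordantBlowup.plusOpens I).ι := inferInstance
  exact MorphismProperty.comp_mem @LocallyOfFiniteType _ _ hι hπ

/-- If `A[t⁻¹, Iₙ tⁿ]` is a regular ring, the cobordant blow-up `B₊` — an open subscheme of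
`B = Spec A[t⁻¹, Iₙ tⁿ]` — is a regular scheme. [folklore] -/
theorem affineCobordantBlowup_plus_isRegular [IsRegularRing (extReesAlgebra I)] :
    Scheme.IsRegular (affineCobordantBlowup.plus I) := by
  haveI : IsRegularRing (CommRingCat.of (extReesAlgebra I)) := ‹_›
  have hB : Scheme.IsRegular (affineCobordantBlowup I) :=
    Scheme.isRegular_Spec (.of (extReesAlgebra I))
  have hplus := hB.of_isOpenImmersion (affineCobordantBlowup.plusOpens I).ι
  exact hplus

/-- If `A[t⁻¹, Iₙ tⁿ]` is a Noetherian ring, the underlying space of the cobordant blow-up `B₊`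
(an open subspace of `Spec A[t⁻¹, Iₙ tⁿ]`) is Noetherian. [folklore] -/
theorem affineCobordantBlowup_plus_noetherianSpace [IsNoetherianRing (extReesAlgebra I)] :
    NoetherianSpace (affineCobordantBlowup.plus I) := by
  haveI : IsNoetherianRing (CommRingCat.of (extReesAlgebra I)) := ‹_›
  have hSpec : NoetherianSpace (Spec (CommRingCat.of (extReesAlgebra I))) := inferInstance
  haveI hB : NoetherianSpace (affineCobordantBlowup I) := hSpec
  have hplus := (affineCobordantBlowup.plusOpens I).ι.isOpenEmbedding.isInducing.noetherianSpace
  exact hplus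

end Affine

/-- **`B₊(U)` is smooth, separated and quasi-compact over `k`, given regularity and finite type
of the extended Rees algebra of the chart** (Włodarczyk 2.3.9 for the datum's charts): for a Rees
algebra `R` on `Y`, `f : Y → Spec k` smooth separated quasi-compact with `k` perfect, and an
affine open `U` whose extended Rees algebra `Γ(Y, U)[t⁻¹, Rₙ(U) tⁿ]` is a regular ring of
finite type over `Γ(Y, U)`, the structure morphism `B₊(U) → U ⊆ Y → Spec k` is smooth (regular +
locally of finite type over a perfect field), separated (composite of open immersions, an affine
morphism and `f`) and quasi-compact (its source is a Noetherian space). -/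
theorem stub_cobordantPlus_smooth_of_isRegularRing :
    ∀ ⦃k : Type⦄ [Field k] [PerfectField k] ⦃Y : Scheme.{0}⦄ (f : Y ⟶ Spec (.of k))
      [Smooth f] [IsSeparated f] [QuasiCompact f] (R : ReesAlgebraData Y) (U : Y.affineOpens),
      IsRegularRing (extReesAlgebra (R.chartIdeals U)) →
      Algebra.FiniteType Γ(Y, U) (extReesAlgebra (R.chartIdeals U)) →
      Smooth (R.cobordantPlusι U ≫ f) ∧ IsSeparated (R.cobordantPlusι U ≫ f) ∧
        QuasiCompact (R.cobordantPlusι U ≫ f) := by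
  intro k _ _ Y f _ _ _ R U hreg hft
  -- the open immersion `Spec Γ(Y, U) ≅ U ↪ Y`
  have hsepU : IsSeparated U.2.fromSpec := inferInstance
  have hftU : LocallyOfFiniteType U.2.fromSpec := inferInstance
  -- `R.cobordantPlusι U = σ₊ ≫ (Spec Γ(Y, U) → Y)` is separated and locally of finite type
  haveI hsepι : IsSeparated (R.cobordantPlusι U) :=
    MorphismProperty.comp_mem @IsSeparated _ _
      (affineCobordantBlowup_plusπ_isSeparated (R.chartIdeals U)) hsepU
  haveI hftι : LocallyOfFiniteType (R.cobordantPlusι U) :=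
    MorphismProperty.comp_mem @LocallyOfFiniteType _ _
      (affineCobordantBlowup_plusπ_locallyOfFiniteType (R.chartIdeals U) hft) hftU
  -- hence so is the structure morphism to `Spec k`
  haveI hsep : IsSeparated (R.cobordantPlusι U ≫ f) :=
    MorphismProperty.comp_mem @IsSeparated _ _ hsepι inferInstance
  haveI hlft : LocallyOfFiniteType (R.cobordantPlusι U ≫ f) :=
    MorphismProperty.comp_mem @LocallyOfFiniteType _ _ hftι inferInstance
  -- regularity and Noetherianity of the source `B₊(U)`
  have hregular : Scheme.IsRegular (R.cobordantPlus U) :=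
    affineCobordantBlowup_plus_isRegular (R.chartIdeals U)
  haveI hnoeth : NoetherianSpace (R.cobordantPlus U) :=
    affineCobordantBlowup_plus_noetherianSpace (R.chartIdeals U)
  have hqc : QuasiCompact (R.cobordantPlusι U ≫ f) :=
    quasiCompact_of_noetherianSpace_source _
  exact ⟨smooth_of_isRegular_of_perfectField (R.cobordantPlusι U ≫ f) hregular, hsep, hqc⟩

end Summit.ResolutionOfSingularities.ResolutionOfSingularities.Theorems
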